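import Summits.ResolutionOfSingularities.ResolutionOfSingularities.Theorems.FrobeniusLadderFInjectiveMacaulayficationKLocCellNorm
import HarnessLib

/-!
# The TRUNCATED certificate check for the Fedder cells `KLocCellMod` (crux `FInjectiveMacaulayfication`, road B / U11 computable half)

[OURS · L1 W4.5a] Support file for crux stmt-ResolutionOfSingularities-15315 (the «kit owner's» computable half named in the header of
res-L1-w45a-stub-3's `…KLocCellMod.lean` p524278 (U11, res-L1-w45a-plan-1 R12.31 / R12.47 D2); author res-D-pv-018 AS res-L1-w45a-stub-6,
author of `KLocCellKit` / `KLocCellSound` / `KLocCellNorm`; motivated by res-L1-w45a-stub-2's measured finding 2026-08-27T14:28:28Z: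
at `p = 11` the exact split of `g^(p-1)` has 2431 terms per `T₁₁` chart and one `decide +kernel` no longer passes, while the
per-stratum truncation keeps `≤ 1001` terms).
THE POINT (U11): on the stratum `S` (`a_i = 0` for `i ∈ S`) Fedder's test only needs `g^(p-1)` MODULO `(Y_i^p : i ∈ S)`, so every term
divisible by some `Y_i^p`, `i ∈ S`, may be dropped — and may be dropped ALREADY DURING the power computation, after each multiplication
(the ideal is closed under multiplication by `g`).  This file adds to the kit, without touching any landed declaration:
`keepS` / `truncKS` (the filter), `powKMod` (the truncating power), `checkKMod` / `checkKsMod` (one stratum / all strata of a chart; the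
chart polynomial is first kit-normalised by `normL`, so `G` may be listed in any term order), the soundness lemmas
`monomial_mem_spanPow`, `evalK_truncKS_sub_mem`, `evalK_powKMod_sub_mem` (the truncated power differs from `g^m` by an element of
`Ideal.span ((fun i => X i ^ p) '' S)`), and the packaged theorems **`klocCellMod_of_check`** / **`klocCellsMod_of_check`**: from
`checkKsMod p G cells = true` — one `decide` — the WEAKENED cells binder `hcellsMod` of `KLocCellMod.fedderAt_of_kLocCell_mod` /
`KLocCellMod.honQuot_of_kLocCells_mod_range` VERBATIM (split identity modulo `(Y_i^p : i ∈ S)`, cofactor identity exact) for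
`g = evalL K G`.  The cofactor data of a truncated cell refer to the TRUNCATED split (e.g. a `const` stratum needs no `t_i` at all).
Definitions are computable list programs (no instances, no notation); AI-written, weaker than expert review; no statement of
[claim: Hironaka2017] is used. [folklore; cite: Fedder1983, Prop. 1.7 (criterion, as consumed by `KLocCellMod`)]
-/

-- single-problem summit: the doubled namespace component is forced
set_option linter.dupNamespace false

namespace Summit.ResolutionOfSingularities.ResolutionOfSingularities.Theorems.FInjectiveMacaulayfication.KLocCellKit

open MvPolynomial

variable {n : ℕ}

/-! ## The list programs -/

/-- Keep a keyed term iff NO variable of `S` occurs with exponent `≥ p` (truncation modulo `(Y_i^p : i ∈ S)`). [folklore] -/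
def keepS (p : ℕ) (S : Finset (Fin n)) (t : ℤ × ℕ × (Fin n → ℕ)) : Bool :=
  decide (∀ i ∈ S, t.2.2 i < p)

/-- Drop every keyed term divisible by some `Y_i^p`, `i ∈ S` (a sublist: key order and collectedness are preserved). [folklore] -/
def truncKS (p : ℕ) (S : Finset (Fin n)) (L : List (ℤ × ℕ × (Fin n → ℕ))) : List (ℤ × ℕ × (Fin n → ℕ)) :=
  L.filter (keepS p S)

/-- The TRUNCATING normalising power: truncate modulo `(Y_i^p : i ∈ S)` after every multiplication. [folklore] -/
def powKMod (p : ℕ) (S : Finset (Fin n)) (G : List (ℤ × ℕ × (Fin n → ℕ))) : ℕ → List (ℤ × ℕ × (Fin n → ℕ))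
  | 0 => [(1, 0, 0)]
  | m + 1 => truncKS p S (mulK G (powKMod p S G m))

/-- **THE ONE BOOLEAN CHECK of a TRUNCATED G2 cell** (stratum `S`): distinct residue keys of the split of the truncated `g^(p-1)` and
vanishing (mod `p`) of the cofactor normal form against that truncated split; `G` is kit-normalised first (any term order). [folklore] -/
def checkKMod (p : ℕ) (G : List (ℤ × (Fin n → ℕ))) (S : Finset (Fin n)) (R : List ((Fin n → ℕ) × List (ℤ × (Fin n → ℕ))))
    (T : Fin n → List (ℤ × (Fin n → ℕ))) (T₀ : List (ℤ × (Fin n → ℕ))) : Bool :=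
  let GK := withKey (normL G)
  let gs := splitK p (powKMod p S GK (p - 1))
  pwDistinct (gs.map fun g => g.1) && (cofactorNFK p GK S gs R T T₀).all fun t => decide ((p : ℤ) ∣ t.1)

/-- The truncated check of ALL cells of one chart (one truncated power per stratum): data `(S, R, T, T₀)` per stratum, in the
currency of `checkKs`. [folklore] -/
def checkKsMod (p : ℕ) (G : List (ℤ × (Fin n → ℕ)))
    (cells : List (Finset (Fin n) × List ((Fin n → ℕ) × List (ℤ × (Fin n → ℕ))) × (Fin n → List (ℤ × (Fin n → ℕ))) ×
      List (ℤ × (Fin n → ℕ)))) : Bool :=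
  cells.all fun c => checkKMod p G c.1 c.2.1 c.2.2.1 c.2.2.2

/-! ## Soundness -/

variable (K : Type) [Field K]

/-- A monomial one of whose `S`-exponents is `≥ p` lies in `Ideal.span ((fun i => X i ^ p) '' S)`. [folklore] -/
theorem monomial_mem_spanPow (p : ℕ) (S : Finset (Fin n)) (e : Fin n → ℕ) (c : K) (i : Fin n) (hi : i ∈ S) (he : p ≤ e i) :
    (monomial (Finsupp.equivFunOnFinite.symm e) c : MvPolynomial (Fin n) K) ∈
      Ideal.span ((fun i : Fin n => (MvPolynomial.X i : MvPolynomial (Fin n) K) ^ p) '' (S : Set (Fin n))) := by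
  have hle : Finsupp.single i p ≤ (Finsupp.equivFunOnFinite.symm e : Fin n →₀ ℕ) := by
    rw [Finsupp.single_le_iff]
    simpa using he
  have hsplit : (monomial (Finsupp.equivFunOnFinite.symm e) c : MvPolynomial (Fin n) K) =
      (X i : MvPolynomial (Fin n) K) ^ p * monomial ((Finsupp.equivFunOnFinite.symm e : Fin n →₀ ℕ) - Finsupp.single i p) c := by
    rw [X_pow_eq_monomial, monomial_mul, one_mul, add_tsub_cancel_of_le hle]
  rw [hsplit]
  exact Ideal.mul_mem_right _ _ (Ideal.subset_span ⟨i, hi, rfl⟩)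

/-- **Truncation is sound modulo the ideal**: `evalK (truncKS p S L) − evalK L ∈ Ideal.span ((fun i => X i ^ p) '' S)`. [folklore] -/
theorem evalK_truncKS_sub_mem (p : ℕ) (S : Finset (Fin n)) (L : List (ℤ × ℕ × (Fin n → ℕ))) :
    evalK K (truncKS p S L) - evalK K L ∈
      Ideal.span ((fun i : Fin n => (MvPolynomial.X i : MvPolynomial (Fin n) K) ^ p) '' (S : Set (Fin n))) := by
  induction L with
  | nil => simp [truncKS, evalK]
  | cons t L ih =>
    simp only [truncKS, List.filter_cons] at ih ⊢
    by_cases h : keepS p S t = true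
    · rw [if_pos h, evalK_cons, evalK_cons, add_sub_add_left_eq_sub]
      exact ih
    · rw [if_neg h, evalK_cons, ← sub_sub, sub_right_comm]
      refine Ideal.sub_mem _ ih ?_
      simp only [keepS, decide_eq_true_eq, not_forall, not_lt, exists_prop] at h
      obtain ⟨i, hi, he⟩ := h
      exact monomial_mem_spanPow K p S t.2.2 _ i hi he

/-- **The truncating power is sound modulo the ideal**: `evalK (powKMod p S G m) − (evalK G)^m ∈ Ideal.span ((fun i => X i ^ p) '' S)`.
[folklore] -/
theorem evalK_powKMod_sub_mem (p : ℕ) (S : Finset (Fin n)) (G : List (ℤ × ℕ × (Fin n → ℕ))) :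
    ∀ m : ℕ, evalK K (powKMod p S G m) - evalK K G ^ m ∈
      Ideal.span ((fun i : Fin n => (MvPolynomial.X i : MvPolynomial (Fin n) K) ^ p) '' (S : Set (Fin n)))
  | 0 => by
    rw [powKMod, evalK_cons, evalK_nil, add_zero, pow_zero, Int.cast_one, monomial_symm_zero K, sub_self]
    exact Ideal.zero_mem _
  | m + 1 => by
    have h1 := evalK_truncKS_sub_mem K p S (mulK G (powKMod p S G m))
    have h2 : evalK K (mulK G (powKMod p S G m)) - evalK K G ^ (m + 1) ∈
        Ideal.span ((fun i : Fin n => (MvPolynomial.X i : MvPolynomial (Fin n) K) ^ p) '' (S : Set (Fin n))) := by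
      rw [evalK_mulK, pow_succ', ← mul_sub]
      exact Ideal.mul_mem_left _ _ (evalK_powKMod_sub_mem p S G m)
    have h3 := Ideal.add_mem _ h1 h2
    rw [sub_add_sub_cancel] at h3
    rw [powKMod]
    exact h3

/-- **THE TRUNCATED G2 CELL FROM ONE KERNEL CHECK.**  For a chart polynomial given as a term list `G` (`g = evalL K G`, any term order),
a stratum `S`, cofactor data `R` (per residue of the TRUNCATED split), `T` (per variable of `S`) and `T₀`: if
`checkKMod p G S R T T₀ = true`, then the weakened per-stratum binder of `KLocCellMod` (§2′ `fedderAt_of_kLocCell_mod`) holds VERBATIM: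
`∃ L rr t t₀, (L.map Prod.fst).Nodup ∧ (∀ e ∈ L, ∀ i, e.1 i < p) ∧ g ^ (p - 1) − (L.map fun e => monomial e.1 1 * expand p e.2).sum
∈ Ideal.span ((fun i => X i ^ p) '' S) ∧ 1 = (zipWith (fun r e => r * expand p e.2) rr L).sum + Σ_{i ∈ S} t i * X i + t₀ * g`.
[folklore] -/
theorem klocCellMod_of_check (p : ℕ) [Fact p.Prime] [CharP K p] (G : List (ℤ × (Fin n → ℕ))) (S : Finset (Fin n))
    (R : List ((Fin n → ℕ) × List (ℤ × (Fin n → ℕ)))) (T : Fin n → List (ℤ × (Fin n → ℕ))) (T₀ : List (ℤ × (Fin n → ℕ)))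
    (hcheck : checkKMod p G S R T T₀ = true) :
    ∃ (L : List ((Fin n →₀ ℕ) × MvPolynomial (Fin n) K)) (rr : List (MvPolynomial (Fin n) K))
      (t : Fin n → MvPolynomial (Fin n) K) (t₀ : MvPolynomial (Fin n) K),
      (L.map Prod.fst).Nodup ∧ (∀ e ∈ L, ∀ i : Fin n, e.1 i < p) ∧
      evalL K G ^ (p - 1) - (L.map fun e => MvPolynomial.monomial e.1 (1 : K) * MvPolynomial.expand p e.2).sum ∈
        Ideal.span ((fun i : Fin n => (MvPolynomial.X i : MvPolynomial (Fin n) K) ^ p) '' (S : Set (Fin n))) ∧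
      (1 : MvPolynomial (Fin n) K) = (List.zipWith (fun r e => r * MvPolynomial.expand p e.2) rr L).sum +
        ∑ i ∈ S, t i * MvPolynomial.X i + t₀ * evalL K G := by
  have hp : 0 < p := (Fact.out : p.Prime).pos
  simp only [checkKMod, Bool.and_eq_true, List.all_eq_true, decide_eq_true_eq] at hcheck
  obtain ⟨hkeys, hcof⟩ := hcheck
  have hGK : evalK K (withKey (normL G)) = evalL K G := by rw [evalK_withKey, evalL_normL]
  refine ⟨(splitK p (powKMod p S (withKey (normL G)) (p - 1))).map fun g => (Finsupp.equivFunOnFinite.symm g.2.1, evalK K g.2.2),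
    (splitK p (powKMod p S (withKey (normL G)) (p - 1))).map fun g => evalK K (lookupRK R g.1 g.2.1), fun i => evalL K (T i),
    evalL K T₀, splitK_nodup K p hp _ (pairwise_of_pwDistinct _ hkeys), ?_, ?_, ?_⟩
  · intro e he i
    obtain ⟨g, hg, rfl⟩ := List.mem_map.mp he
    simpa using (splitK_inv p hp _ g hg).2 i
  · rw [← evalK_splitK K p, ← hGK, ← Ideal.neg_mem_iff, neg_sub]
    exact evalK_powKMod_sub_mem K p S _ (p - 1)
  · have h := evalK_cofactorNFK K p (withKey (normL G)) S (splitK p (powKMod p S (withKey (normL G)) (p - 1))) R T T₀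
    rw [evalK_eq_zero_of_dvd K p _ hcof, hGK] at h
    exact (sub_eq_zero.mp h.symm).symm

/-- **ALL TRUNCATED G2 CELLS OF ONE CHART FROM ONE KERNEL CHECK** (`checkKsMod`: one truncated power and one cofactor identity per
listed stratum): the weakened cells binder `hcellsMod` of `KLocCellMod.honQuot_of_kLocCells_mod_range` for `SS = cells.map Prod.fst`
and `g = evalL K G`. [folklore] -/
theorem klocCellsMod_of_check (p : ℕ) [Fact p.Prime] [CharP K p] (G : List (ℤ × (Fin n → ℕ)))
    (cells : List (Finset (Fin n) × List ((Fin n → ℕ) × List (ℤ × (Fin n → ℕ))) × (Fin n → List (ℤ × (Fin n → ℕ))) ×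
      List (ℤ × (Fin n → ℕ))))
    (hcheck : checkKsMod p G cells = true) :
    ∀ S ∈ cells.map Prod.fst, ∃ (L : List ((Fin n →₀ ℕ) × MvPolynomial (Fin n) K)) (rr : List (MvPolynomial (Fin n) K))
      (t : Fin n → MvPolynomial (Fin n) K) (t₀ : MvPolynomial (Fin n) K),
      (L.map Prod.fst).Nodup ∧ (∀ e ∈ L, ∀ i : Fin n, e.1 i < p) ∧
      evalL K G ^ (p - 1) - (L.map fun e => MvPolynomial.monomial e.1 (1 : K) * MvPolynomial.expand p e.2).sum ∈
        Ideal.span ((fun i : Fin n => (MvPolynomial.X i : MvPolynomial (Fin n) K) ^ p) '' (S : Set (Fin n))) ∧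
      (1 : MvPolynomial (Fin n) K) = (List.zipWith (fun r e => r * MvPolynomial.expand p e.2) rr L).sum +
        ∑ i ∈ S, t i * MvPolynomial.X i + t₀ * evalL K G := by
  intro S hS
  obtain ⟨c, hc, rfl⟩ := List.mem_map.mp hS
  simp only [checkKsMod, List.all_eq_true] at hcheck
  exact klocCellMod_of_check K p G c.1 c.2.1 c.2.2.1 c.2.2.2 (hcheck c hc)

/-- Explicit-strata-list form (statement shape of the campaign files: `∀ S ∈ SS` for a literal `SS`). [folklore] -/
theorem klocCellsMod_of_check' (p : ℕ) [Fact p.Prime] [CharP K p] (G : List (ℤ × (Fin n → ℕ))) (SS : List (Finset (Fin n)))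
    (cells : List (Finset (Fin n) × List ((Fin n → ℕ) × List (ℤ × (Fin n → ℕ))) × (Fin n → List (ℤ × (Fin n → ℕ))) ×
      List (ℤ × (Fin n → ℕ))))
    (hSS : cells.map Prod.fst = SS) (hcheck : checkKsMod p G cells = true) :
    ∀ S ∈ SS, ∃ (L : List ((Fin n →₀ ℕ) × MvPolynomial (Fin n) K)) (rr : List (MvPolynomial (Fin n) K))
      (t : Fin n → MvPolynomial (Fin n) K) (t₀ : MvPolynomial (Fin n) K),
      (L.map Prod.fst).Nodup ∧ (∀ e ∈ L, ∀ i : Fin n, e.1 i < p) ∧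
      evalL K G ^ (p - 1) - (L.map fun e => MvPolynomial.monomial e.1 (1 : K) * MvPolynomial.expand p e.2).sum ∈
        Ideal.span ((fun i : Fin n => (MvPolynomial.X i : MvPolynomial (Fin n) K) ^ p) '' (S : Set (Fin n))) ∧
      (1 : MvPolynomial (Fin n) K) = (List.zipWith (fun r e => r * MvPolynomial.expand p e.2) rr L).sum +
        ∑ i ∈ S, t i * MvPolynomial.X i + t₀ * evalL K G := by
  rw [← hSS]
  exact klocCellsMod_of_check K p G cells hcheck

end Summit.ResolutionOfSingularities.ResolutionOfSingularities.Theorems.FInjectiveMacaulayfication.KLocCellKit
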